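import Literature.AlgebraicGeometry.HodgeTheory.SimpleAbelianSevenfoldHodgeClassesAll
import Literature.AlgebraicGeometry.HodgeTheory.RibetTypeFourCoprimePowersHodgeClasses
import Literature.AlgebraicGeometry.HodgeTheory.RibetTypeHigherCoprimePowersHodgeClasses
import HarnessLib

/-!
# Hodge classes on powers of SIMPLE complex abelian varieties of dimension 11 and 13: what the Tankeev–Ribet theorem
# still needs there (Moonen–Zarhin 1999 Thm. (2.7) at the primes 11, 13; Ribet 1983 Thms. 0–3) — census

Family `hodge`, layer `Literature/AlgebraicGeometry/HodgeTheory`. Research context: cell `pub-hodge-ring2` (HONEST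
FRAMING: research route conditional on HC_CM; not a corollary; Q11.4-sentence-2 already refuted in dim ≥ 3),
Literature lane gen 83, programme R64, THE CENSUS OF DIMENSIONS 11 AND 13. UNCONDITIONAL; theorems only, no definition,
no named fact (D-0026), no `sorry`. The tree's `isDivisorGenerated_powSucc_of_isSimple_of_prime_of_odd_of_ge_four`
(`SimpleAbelianSevenfoldHodgeClassesAll`) reduces `B = D` on the powers of a simple abelian variety of odd prime dimension
to the generic shape `End⁰ = ℚ` and to the imaginary-quadratic shapes with both multiplicities `≥ 4`; this file feeds in
the new unconditional cells `(4,7)`/`(7,4)` of dimension `11` (`RibetTypeFourCoprimePowersHodgeClasses`) and `(6,7)`/`(7,6)`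
of dimension `13` (`RibetTypeHigherCoprimePowersHodgeClasses`), leaving NAMED hypotheses for exactly the remaining shapes:
dimension `11`: `End⁰ = ℚ` (`Hg = Sp₂₂`) and the signature `{5, 6}`; dimension `13`: `End⁰ = ℚ` (`Hg = Sp₂₆`) and the
signatures `{4, 9}`, `{5, 8}`.

THE PRINTED THEOREM. B. Moonen, Yu. Zarhin, Math. Ann. 315 (1999), Thm. (2.7) [held `paper:arxiv-math_9901113` p0005]:
«Let `X` be a simple complex abelian variety such that `dim(X)` is a prime number. Then `Hg(X) = Sp_D(V,φ)` and
`B•(Xⁿ) = D•(Xⁿ)` for every `n ≥ 1`» (Tankeev; Ribet 1983).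

## References
* [MoonenZarhin1999LowDim] B. Moonen, Yu. Zarhin, Math. Ann. 315 (1999), §2 (2.4)–(2.7).
* [Ribet1983] K. A. Ribet, Amer. J. Math. 105 (1983), Thms. 0–3.
* [Gordon1997] B. B. Gordon, *A survey of the Hodge conjecture for abelian varieties*, Thm. 6.3 and Corollary.
* [Deligne2000] P. Deligne, *The Hodge conjecture* (Clay, 2000), §1.
-/

noncomputable section

open CategoryTheory Module

namespace Literature.AlgebraicGeometry.HodgeTheory

open Literature.AlgebraicGeometry.Motives

variable {X : AbelianVariety ℂ}

section Main

/-- **`B•(X^{N+1}) = D•(X^{N+1})` for a SIMPLE complex abelian ELEVENFOLD, granted only the shapes `End⁰(X) = ℚ`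
(hypothesis `h1`) and `End⁰ = k` imaginary quadratic with multiplicities `{5, 6}` (hypothesis `h56`)** — every other
Albert shape of dimension `11` is an unconditional theorem of the tree: totally real / CM as in
`SimpleOddPrimeDimensionHodgeClasses`, signatures `(1,10)` (type one), `(2,9)` (`(2, odd)` core), `(3,8)` (`(3, 3∤·)`
core), `(4,7)` (`AbelianVariety.isDivisorGenerated_powSucc_of_elevenfold_fourSeven`) and their mirrors.
[cite: MoonenZarhin1999LowDim, §2 (2.4) and Thm. (2.7)] [cite: Ribet1983, Thms. 0–3] [cite: Gordon1997, Thm. 6.3 and Corollary] -/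
theorem isDivisorGenerated_powSucc_of_isSimple_elevenfold (hs : X.IsSimple) (hX : X.dim = 11)
    (h1 : Module.finrank ℚ X.endAlgebra = 1 → ∀ N : ℕ, IsDivisorGenerated (X.powSucc N))
    (h56 : ∀ (φ : X ⟶ X) (d : ℕ), 0 < d → φ ≫ φ = -(d • 𝟙 X) → Module.finrank ℚ X.endAlgebra = 2 →
      (eigenMultiplicity X φ (Complex.I * (Real.sqrt d : ℂ)) = 5 ∨
        eigenMultiplicity X φ (Complex.I * (Real.sqrt d : ℂ)) = 6) → ∀ N : ℕ, IsDivisorGenerated (X.powSucc N))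
    (N : ℕ) : IsDivisorGenerated (X.powSucc N) := by
  refine isDivisorGenerated_powSucc_of_isSimple_of_prime_of_odd_of_ge_four hs (by rw [hX]; norm_num)
    (by rw [hX]; exact ⟨5, rfl⟩) h1 (fun φ d hd hφ he2 ha hb N => ?_) N
  have hsum := eigenMultiplicity_add_eigenMultiplicity_neg_eq_dim X φ hd hφ
  rw [hX] at hsum
  by_cases h4 : eigenMultiplicity X φ (Complex.I * (Real.sqrt d : ℂ)) = 4 ∨
      eigenMultiplicity X φ (-(Complex.I * (Real.sqrt d : ℂ))) = 4
  · exact AbelianVariety.isDivisorGenerated_powSucc_of_elevenfold_fourSeven X φ hd hφ he2 hX h4 N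
  · simp only [not_or] at h4
    exact h56 φ d hd hφ he2 (by omega) N

/-- **The Hodge conjecture for all powers of a simple complex abelian ELEVENFOLD, granted the shapes `End⁰ = ℚ` and
`{5, 6}`.** [cite: MoonenZarhin1999LowDim, §2 Thm. (2.7)] [cite: Deligne2000, §1] -/
theorem hodgeConjectureFor_powSucc_of_isSimple_elevenfold (hs : X.IsSimple) (hX : X.dim = 11)
    (h1 : Module.finrank ℚ X.endAlgebra = 1 → ∀ N : ℕ, IsDivisorGenerated (X.powSucc N))
    (h56 : ∀ (φ : X ⟶ X) (d : ℕ), 0 < d → φ ≫ φ = -(d • 𝟙 X) → Module.finrank ℚ X.endAlgebra = 2 →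
      (eigenMultiplicity X φ (Complex.I * (Real.sqrt d : ℂ)) = 5 ∨
        eigenMultiplicity X φ (Complex.I * (Real.sqrt d : ℂ)) = 6) → ∀ N : ℕ, IsDivisorGenerated (X.powSucc N))
    (N : ℕ) : HodgeConjectureFor (X.powSucc N).dim (X.powSucc N).X :=
  hodgeConjectureFor_of_isDivisorGenerated _ (isDivisorGenerated_powSucc_of_isSimple_elevenfold hs hX h1 h56 N)

/-- **`B•(X^{N+1}) = D•(X^{N+1})` for a SIMPLE complex abelian THIRTEENFOLD, granted only the shapes `End⁰(X) = ℚ`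
(hypothesis `h1`) and `End⁰ = k` imaginary quadratic with multiplicities `{4, 9}` (`h49`) or `{5, 8}` (`h58`)** —
signatures `(1,12)`, `(2,11)`, `(3,10)` by the tree's cores and `(6,7)`/`(7,6)` by
`AbelianVariety.isDivisorGenerated_powSucc_of_thirteenfold_sixSeven`; totally real / CM as in
`SimpleOddPrimeDimensionHodgeClasses`. [cite: MoonenZarhin1999LowDim, §2 (2.4) and Thm. (2.7)] [cite: Ribet1983, Thms. 0–3]
[cite: Gordon1997, Thm. 6.3 and Corollary] -/
theorem isDivisorGenerated_powSucc_of_isSimple_thirteenfold (hs : X.IsSimple) (hX : X.dim = 13)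
    (h1 : Module.finrank ℚ X.endAlgebra = 1 → ∀ N : ℕ, IsDivisorGenerated (X.powSucc N))
    (h49 : ∀ (φ : X ⟶ X) (d : ℕ), 0 < d → φ ≫ φ = -(d • 𝟙 X) → Module.finrank ℚ X.endAlgebra = 2 →
      (eigenMultiplicity X φ (Complex.I * (Real.sqrt d : ℂ)) = 4 ∨
        eigenMultiplicity X φ (Complex.I * (Real.sqrt d : ℂ)) = 9) → ∀ N : ℕ, IsDivisorGenerated (X.powSucc N))
    (h58 : ∀ (φ : X ⟶ X) (d : ℕ), 0 < d → φ ≫ φ = -(d • 𝟙 X) → Module.finrank ℚ X.endAlgebra = 2 →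
      (eigenMultiplicity X φ (Complex.I * (Real.sqrt d : ℂ)) = 5 ∨
        eigenMultiplicity X φ (Complex.I * (Real.sqrt d : ℂ)) = 8) → ∀ N : ℕ, IsDivisorGenerated (X.powSucc N))
    (N : ℕ) : IsDivisorGenerated (X.powSucc N) := by
  refine isDivisorGenerated_powSucc_of_isSimple_of_prime_of_odd_of_ge_four hs (by rw [hX]; norm_num)
    (by rw [hX]; exact ⟨6, rfl⟩) h1 (fun φ d hd hφ he2 ha hb N => ?_) N
  have hsum := eigenMultiplicity_add_eigenMultiplicity_neg_eq_dim X φ hd hφ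
  rw [hX] at hsum
  by_cases h6 : eigenMultiplicity X φ (Complex.I * (Real.sqrt d : ℂ)) = 6 ∨
      eigenMultiplicity X φ (-(Complex.I * (Real.sqrt d : ℂ))) = 6
  · exact AbelianVariety.isDivisorGenerated_powSucc_of_thirteenfold_sixSeven X φ hd hφ he2 hX h6 N
  · simp only [not_or] at h6
    by_cases h49' : eigenMultiplicity X φ (Complex.I * (Real.sqrt d : ℂ)) = 4 ∨
        eigenMultiplicity X φ (Complex.I * (Real.sqrt d : ℂ)) = 9
    · exact h49 φ d hd hφ he2 h49' N
    · simp only [not_or] at h49'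
      exact h58 φ d hd hφ he2 (by omega) N

/-- **The Hodge conjecture for all powers of a simple complex abelian THIRTEENFOLD, granted the shapes `End⁰ = ℚ`,
`{4, 9}` and `{5, 8}`.** [cite: MoonenZarhin1999LowDim, §2 Thm. (2.7)] [cite: Deligne2000, §1] -/
theorem hodgeConjectureFor_powSucc_of_isSimple_thirteenfold (hs : X.IsSimple) (hX : X.dim = 13)
    (h1 : Module.finrank ℚ X.endAlgebra = 1 → ∀ N : ℕ, IsDivisorGenerated (X.powSucc N))
    (h49 : ∀ (φ : X ⟶ X) (d : ℕ), 0 < d → φ ≫ φ = -(d • 𝟙 X) → Module.finrank ℚ X.endAlgebra = 2 →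
      (eigenMultiplicity X φ (Complex.I * (Real.sqrt d : ℂ)) = 4 ∨
        eigenMultiplicity X φ (Complex.I * (Real.sqrt d : ℂ)) = 9) → ∀ N : ℕ, IsDivisorGenerated (X.powSucc N))
    (h58 : ∀ (φ : X ⟶ X) (d : ℕ), 0 < d → φ ≫ φ = -(d • 𝟙 X) → Module.finrank ℚ X.endAlgebra = 2 →
      (eigenMultiplicity X φ (Complex.I * (Real.sqrt d : ℂ)) = 5 ∨
        eigenMultiplicity X φ (Complex.I * (Real.sqrt d : ℂ)) = 8) → ∀ N : ℕ, IsDivisorGenerated (X.powSucc N))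
    (N : ℕ) : HodgeConjectureFor (X.powSucc N).dim (X.powSucc N).X :=
  hodgeConjectureFor_of_isDivisorGenerated _ (isDivisorGenerated_powSucc_of_isSimple_thirteenfold hs hX h1 h49 h58 N)

end Main

end Literature.AlgebraicGeometry.HodgeTheory

end
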